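import Summits.ValiantsHypothesis.ValiantsHypothesis.Theorems.KPlusLogSqLawWindowDescartesSmoothing

/-!
# Window Descartes rule — part 3: the two-sided geometric kernel

Continuation (seat val-sym-lift-p4 (g2), GAP-LIFT §7).  For `0 < a < b` the KERNEL is `Kf k s = b⁻¹^(k-s)` (`s ≤ k`),
`a^(s-k)` (`s > k`); the SMOOTHED COEFFICIENTS of `c : ℕ → ℝ` on `[0, N]` are `H k = ∑_{s ≤ N} c s · Kf k s` — the Laurent
coefficients (up to the factor `1 - a/b`) of `f(x) / ((1 - x/b)(1 - a/x))` on the annulus `a < x < b`, `f = ∑ c s X^s`, kept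
here as explicit finite sums (no series).  (7a) `sgnChanges_kernel_le`: the kernel is VARIATION DIMINISHING on a finite range
(two applications of the smoothing lemma: right smoothing with ratio `a`, left smoothing with ratio `b⁻¹`, glued by an exact
finite identity); (7b) `kernel_low_pos` / `kernel_high_pos`: if the monomial of degree `p` DOMINATES at `a`
(`∑_{s ≠ p} |c s| a^s < |c p| a^p`) then `H k` has the sign of `c p` for all `k ≤ p`; if degree `q` dominates at `b` then `H k`
has the sign of `c q` for all `k ≥ q`.  HONEST FRAMING: elementary real algebra; no statement of the cell is touched.
[folklore; the two-sided kernel is the Green's function of the three-term recurrence `(1 + a/b) u_k - u_{k-1}/b - a u_{k+1}`]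
-/

set_option linter.dupNamespace false
set_option autoImplicit false

namespace Summit.ValiantsHypothesis.ValiantsHypothesis.Theorems.KPlusLogSqLaw.WindowDescartes

open Polynomial

/-! ## 7. The two-sided geometric kernel: variation diminishing on a finite range

For `0 < a < b` the kernel is `Kf i j = b⁻¹^(i-j)` (`j ≤ i`) and `a^(j-i)` (`j > i`); the smoothed sequence of `d` on
`[0, n]` is `u i = ∑_{j ≤ n} d j · Kf i j`.  CLAIM: `[u n, …, u 0]` has at most as many sign changes as `[d n, …, d 0]`.
Proof: `(1 - a/b) · V = u` where `w i = ∑_{i ≤ j ≤ n} d j a^(j-i)` (smoothing from the right, ratio `a`) and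
`V 0 = w 0 · b/(b-a)`, `V (i+1) = b⁻¹ V i + w (i+1)` (smoothing from the left, ratio `b⁻¹`); two applications of the
smoothing lemma. -/

section Kernel

variable {a b : ℝ}

/-- **Variation diminishing of the two-sided geometric kernel** on a finite range. -/
theorem sgnChanges_kernel_le (ha : 0 < a) (hab : a < b) (d : ℕ → ℝ) (n : ℕ) :
    sgnChanges (slist (fun i => ∑ j ∈ Finset.range (n + 1),
      d j * (if j ≤ i then b⁻¹ ^ (i - j) else a ^ (j - i))) n) ≤ sgnChanges (slist d n) := by
  have hb : 0 < b := ha.trans hab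
  have hb0 : b ≠ 0 := hb.ne'
  have hba : 0 < b - a := sub_pos.mpr hab
  -- right smoothing `w` and the tail sums `A`
  set A : ℕ → ℝ := fun i => ∑ j ∈ Finset.Ico (i + 1) (n + 1), d j * a ^ (j - i) with hA
  set w : ℕ → ℝ := fun i => ∑ j ∈ Finset.Ico i (n + 1), d j * a ^ (j - i) with hw
  have hwA : ∀ i, i ≤ n → w i = d i + A i := by
    intro i hi
    simp only [hw, hA]
    rw [Finset.sum_eq_sum_Ico_succ_bot (by omega : i < n + 1), Nat.sub_self, pow_zero, mul_one]
  have hArec : ∀ i, i < n → A i = a * (d (i + 1) + A (i + 1)) := by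
    intro i hi
    simp only [hA]
    rw [Finset.sum_eq_sum_Ico_succ_bot (by omega : i + 1 < n + 1), show i + 1 - i = 1 by omega, pow_one,
      mul_add, Finset.mul_sum]
    congr 1
    · ring
    · refine Finset.sum_congr rfl fun j hj => ?_
      rw [Finset.mem_Ico] at hj
      rw [show j - i = (j - (i + 1)) + 1 by omega, pow_succ]
      ring
  have hAn : A n = 0 := by simp only [hA]; rw [Finset.Ico_self, Finset.sum_empty]
  have hwrec : ∀ i, i < n → w i = a * w (i + 1) + d i := by
    intro i hi
    rw [hwA i hi.le, hwA (i + 1) hi, hArec i hi]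
    ring
  have hwn : w n = d n := by rw [hwA n le_rfl, hAn, add_zero]
  -- left smoothing `V`
  let V : ℕ → ℝ := fun i => Nat.rec (w 0 * (b / (b - a))) (fun j Vj => b⁻¹ * Vj + w (j + 1)) i
  have hV0 : V 0 = w 0 * (b / (b - a)) := rfl
  have hVs : ∀ i, V (i + 1) = b⁻¹ * V i + w (i + 1) := fun i => rfl
  -- head sums `B`
  set B : ℕ → ℝ := fun i => ∑ j ∈ Finset.range (i + 1), d j * b⁻¹ ^ (i - j) with hB
  have hB0 : B 0 = d 0 := by simp [hB]
  have hBrec : ∀ i, B (i + 1) = b⁻¹ * B i + d (i + 1) := by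
    intro i
    simp only [hB]
    rw [Finset.sum_range_succ, Nat.sub_self, pow_zero, mul_one, Finset.mul_sum]
    congr 1
    refine Finset.sum_congr rfl fun j hj => ?_
    rw [Finset.mem_range] at hj
    rw [show i + 1 - j = (i - j) + 1 by omega, pow_succ]
    ring
  -- `(1 - a/b) V = B + A` on `[0, n]`
  have hz : ∀ i, i ≤ n → (1 - a / b) * V i = B i + A i := by
    intro i hi
    induction i with
    | zero =>
      rw [hV0, hB0, ← hwA 0 (Nat.zero_le n)]
      field_simp
    | succ i ih =>
      have ih := ih (Nat.le_of_succ_le hi)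
      rw [hVs, hBrec, mul_add, ← mul_assoc, mul_comm (1 - a / b) b⁻¹, mul_assoc, ih, hwA (i + 1) hi,
        hArec i (Nat.lt_of_succ_le hi)]
      field_simp
      ring
  -- the smoothed sequence is `B + A`
  have hu : ∀ i, i ≤ n → (∑ j ∈ Finset.range (n + 1), d j * (if j ≤ i then b⁻¹ ^ (i - j) else a ^ (j - i)))
      = B i + A i := by
    intro i hi
    simp only [hB, hA]
    rw [Finset.range_eq_Ico, Finset.range_eq_Ico, ← Finset.sum_Ico_consecutive _ (Nat.zero_le (i + 1)) (by omega : i + 1 ≤ n + 1)]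
    congr 1
    · refine Finset.sum_congr rfl fun j hj => ?_
      rw [Finset.mem_Ico] at hj
      rw [if_pos (by omega)]
    · refine Finset.sum_congr rfl fun j hj => ?_
      rw [Finset.mem_Ico] at hj
      rw [if_neg (by omega)]
  -- chain
  have e1 : slist (fun i => ∑ j ∈ Finset.range (n + 1), d j * (if j ≤ i then b⁻¹ ^ (i - j) else a ^ (j - i))) n
      = slist (fun i => (1 - a / b) * V i) n := slist_congr fun i hi => by rw [hu i hi, hz i hi]
  have hκ : 0 < 1 - a / b := by rw [sub_pos, div_lt_one hb]; exact hab
  have e2 : sgnChanges (slist (fun i => (1 - a / b) * V i) n) = sgnChanges (slist V n) :=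
    sgnChanges_slist_congr_sign fun i _ => by rw [sign_mul, sign_pos hκ, one_mul]
  have e3 : sgnChanges (slist V n) ≤ sgnChanges (slist w n) := by
    refine sgnChanges_slist_le_of_rec (fun _ => b⁻¹) V w (fun _ => inv_pos.mpr hb) ?_ n (fun k _ => hVs k)
    rw [hV0, sign_mul, sign_pos (div_pos hb hba), mul_one]
  have e4 : sgnChanges (slist w n) ≤ sgnChanges (slist d n) := by
    rw [← sgnChanges_reverse (slist w n), ← sgnChanges_reverse (slist d n), ← slist_reflect, ← slist_reflect]
    refine sgnChanges_slist_le_of_rec (fun _ => a) (fun j => w (n - j)) (fun j => d (n - j)) (fun _ => ha) ?_ n ?_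
    · rw [Nat.sub_zero, hwn]
    · intro k hk
      rw [show n - k = (n - (k + 1)) + 1 by omega]
      exact hwrec _ (by omega)
  rw [e1, e2]
  exact e3.trans e4


/-! ### Dominance ⇒ signs of the smoothed coefficients

`c : ℕ → ℝ` on `[0, N]` (the coefficients of `f`), `H k = ∑_{s ≤ N} c s · Kf k s` the smoothed sequence.  Under
DOMINANCE of the index `p` at `a` the entries `H k`, `k ≤ p`, have the sign of `c p`; under dominance of `q` at `b` the
entries `H k`, `k ≥ q`, have the sign of `c q`. -/

/-- powers: `b ^ t * b⁻¹ ^ (t + i) = b⁻¹ ^ i`. -/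
theorem pow_mul_inv_pow_add {b : ℝ} (hb : b ≠ 0) (t i : ℕ) : b ^ t * b⁻¹ ^ (t + i) = b⁻¹ ^ i := by
  rw [pow_add, ← mul_assoc, ← mul_pow, mul_inv_cancel₀ hb, one_pow, one_mul]

/-- **lower block**: for `k ≤ p`, dominance of `p` at `a` gives `c p · H k > 0`. -/
theorem kernel_low_pos (ha : 0 < a) (hab : a < b) (c : ℕ → ℝ) (N p : ℕ) (hp : p ≤ N)
    (hda : ∑ s ∈ (Finset.range (N + 1)).erase p, |c s| * a ^ s < |c p| * a ^ p) (k : ℕ) (hk : k ≤ p) :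
    0 < c p * ∑ s ∈ Finset.range (N + 1), c s * (if s ≤ k then b⁻¹ ^ (k - s) else a ^ (s - k)) := by
  have hb : 0 < b := ha.trans hab
  set Kk : ℕ → ℝ := fun s => if s ≤ k then b⁻¹ ^ (k - s) else a ^ (s - k) with hKk
  have hK_nn : ∀ s, 0 ≤ Kk s := fun s => by
    simp only [hKk]; split_ifs
    · exact pow_nonneg (inv_nonneg.mpr hb.le) _
    · exact pow_nonneg ha.le _
  have hK_le : ∀ s, a ^ k * Kk s ≤ a ^ s := by
    intro s; simp only [hKk]; split_ifs with h
    · obtain ⟨t, rfl⟩ := Nat.exists_eq_add_of_le h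
      rw [Nat.add_sub_cancel_left, pow_add, mul_assoc]
      refine mul_le_of_le_one_right (pow_nonneg ha.le _) ?_
      rw [← mul_pow]
      refine pow_le_one₀ (mul_nonneg ha.le (inv_nonneg.mpr hb.le)) ?_
      rw [mul_inv_le_iff₀ hb, one_mul]; exact hab.le
    · rw [← pow_add, Nat.add_sub_cancel' (le_of_lt (not_le.mp h))]
  have hK_p : a ^ k * Kk p = a ^ p := by
    simp only [hKk]
    by_cases h : p ≤ k
    · rw [if_pos h, le_antisymm h hk, Nat.sub_self, pow_zero, mul_one]
    · rw [if_neg h, ← pow_add, Nat.add_sub_cancel' hk]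
  have hmem : p ∈ Finset.range (N + 1) := by simp; omega
  rw [← Finset.add_sum_erase _ _ hmem]
  set T := ∑ s ∈ (Finset.range (N + 1)).erase p, c s * Kk s with hT
  have hTb : a ^ k * |T| < |c p| * a ^ p := by
    calc a ^ k * |T| ≤ a ^ k * ∑ s ∈ (Finset.range (N + 1)).erase p, |c s * Kk s| :=
          mul_le_mul_of_nonneg_left (Finset.abs_sum_le_sum_abs _ _) (pow_nonneg ha.le _)
      _ = ∑ s ∈ (Finset.range (N + 1)).erase p, |c s| * (a ^ k * Kk s) := by
          rw [Finset.mul_sum]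
          refine Finset.sum_congr rfl fun s _ => ?_
          rw [abs_mul, abs_of_nonneg (hK_nn s)]; ring
      _ ≤ ∑ s ∈ (Finset.range (N + 1)).erase p, |c s| * a ^ s :=
          Finset.sum_le_sum fun s _ => mul_le_mul_of_nonneg_left (hK_le s) (abs_nonneg _)
      _ < |c p| * a ^ p := hda
  have hcp : c p ≠ 0 := by
    intro h0; rw [h0, abs_zero, zero_mul] at hda
    exact absurd hda (not_lt.mpr (Finset.sum_nonneg fun s _ => mul_nonneg (abs_nonneg _) (pow_nonneg ha.le _)))
  have hak : 0 < a ^ k := pow_pos ha k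
  -- a^k · (c p · (c p Kk p + T)) = c p² a^p + c p · (a^k T) > 0
  have h1 : |c p * (a ^ k * T)| < c p ^ 2 * a ^ p := by
    rw [abs_mul, abs_mul, abs_of_pos hak]
    calc |c p| * (a ^ k * |T|) < |c p| * (|c p| * a ^ p) := mul_lt_mul_of_pos_left hTb (abs_pos.mpr hcp)
      _ = c p ^ 2 * a ^ p := by rw [← mul_assoc, ← sq, sq_abs]
  have h2 := (abs_lt.mp h1).1
  have h3 : 0 < a ^ k * (c p * (c p * Kk p + T)) := by
    have e : a ^ k * (c p * (c p * Kk p + T)) = c p ^ 2 * (a ^ k * Kk p) + c p * (a ^ k * T) := by ring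
    rw [e, hK_p]; linarith
  exact pos_of_mul_pos_right h3 hak.le

/-- powers: `b ^ (s + t) * b⁻¹ ^ t = b ^ s`. -/
theorem pow_add_mul_inv_pow {b : ℝ} (hb : b ≠ 0) (s t : ℕ) : b ^ (s + t) * b⁻¹ ^ t = b ^ s := by
  rw [pow_add, mul_assoc, ← mul_pow, mul_inv_cancel₀ hb, one_pow, mul_one]

/-- **upper block**: for `q ≤ k`, dominance of `q` at `b` gives `c q · H k > 0`. -/
theorem kernel_high_pos (ha : 0 < a) (hab : a < b) (c : ℕ → ℝ) (N q : ℕ) (hq : q ≤ N)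
    (hdb : ∑ s ∈ (Finset.range (N + 1)).erase q, |c s| * b ^ s < |c q| * b ^ q) (k : ℕ) (hk : q ≤ k) :
    0 < c q * ∑ s ∈ Finset.range (N + 1), c s * (if s ≤ k then b⁻¹ ^ (k - s) else a ^ (s - k)) := by
  have hb : 0 < b := ha.trans hab
  have hb0 : b ≠ 0 := hb.ne'
  set Kk : ℕ → ℝ := fun s => if s ≤ k then b⁻¹ ^ (k - s) else a ^ (s - k) with hKk
  have hK_nn : ∀ s, 0 ≤ Kk s := fun s => by
    simp only [hKk]; split_ifs
    · exact pow_nonneg (inv_nonneg.mpr hb.le) _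
    · exact pow_nonneg ha.le _
  have hK_le : ∀ s, b ^ k * Kk s ≤ b ^ s := by
    intro s; simp only [hKk]; split_ifs with h
    · obtain ⟨t, rfl⟩ := Nat.exists_eq_add_of_le h
      rw [Nat.add_sub_cancel_left, pow_add_mul_inv_pow hb0]
    · obtain ⟨t, rfl⟩ := Nat.exists_eq_add_of_le (le_of_lt (not_le.mp h))
      rw [Nat.add_sub_cancel_left, pow_add]
      exact mul_le_mul_of_nonneg_left (pow_le_pow_left₀ ha.le hab.le _) (pow_nonneg hb.le _)
  have hK_q : b ^ k * Kk q = b ^ q := by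
    simp only [hKk]
    rw [if_pos hk]
    obtain ⟨t, rfl⟩ := Nat.exists_eq_add_of_le hk
    rw [Nat.add_sub_cancel_left, pow_add_mul_inv_pow hb0]
  have hmem : q ∈ Finset.range (N + 1) := by simp; omega
  rw [← Finset.add_sum_erase _ _ hmem]
  set T := ∑ s ∈ (Finset.range (N + 1)).erase q, c s * Kk s with hT
  have hTb : b ^ k * |T| < |c q| * b ^ q := by
    calc b ^ k * |T| ≤ b ^ k * ∑ s ∈ (Finset.range (N + 1)).erase q, |c s * Kk s| :=
          mul_le_mul_of_nonneg_left (Finset.abs_sum_le_sum_abs _ _) (pow_nonneg hb.le _)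
      _ = ∑ s ∈ (Finset.range (N + 1)).erase q, |c s| * (b ^ k * Kk s) := by
          rw [Finset.mul_sum]
          refine Finset.sum_congr rfl fun s _ => ?_
          rw [abs_mul, abs_of_nonneg (hK_nn s)]; ring
      _ ≤ ∑ s ∈ (Finset.range (N + 1)).erase q, |c s| * b ^ s :=
          Finset.sum_le_sum fun s _ => mul_le_mul_of_nonneg_left (hK_le s) (abs_nonneg _)
      _ < |c q| * b ^ q := hdb
  have hcq : c q ≠ 0 := by
    intro h0; rw [h0, abs_zero, zero_mul] at hdb
    exact absurd hdb (not_lt.mpr (Finset.sum_nonneg fun s _ => mul_nonneg (abs_nonneg _) (pow_nonneg hb.le _)))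
  have hbk : 0 < b ^ k := pow_pos hb k
  have h1 : |c q * (b ^ k * T)| < c q ^ 2 * b ^ q := by
    rw [abs_mul, abs_mul, abs_of_pos hbk]
    calc |c q| * (b ^ k * |T|) < |c q| * (|c q| * b ^ q) := mul_lt_mul_of_pos_left hTb (abs_pos.mpr hcq)
      _ = c q ^ 2 * b ^ q := by rw [← mul_assoc, ← sq, sq_abs]
  have h2 := (abs_lt.mp h1).1
  have h3 : 0 < b ^ k * (c q * (c q * Kk q + T)) := by
    have e : b ^ k * (c q * (c q * Kk q + T)) = c q ^ 2 * (b ^ k * Kk q) + c q * (b ^ k * T) := by ring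
    rw [e, hK_q]; linarith
  exact pos_of_mul_pos_right h3 hbk.le


end Kernel

end Summit.ValiantsHypothesis.ValiantsHypothesis.Theorems.KPlusLogSqLaw.WindowDescartes
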